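import Summits.HodgeConjecture.HodgeConjecture.Theorems.CurveNetMordellWeilVerticalSupportMiddleChowDegenerate
import Summits.HodgeConjecture.HodgeConjecture.Theorems.CurveNetMordellWeilVerticalSupportMiddleIffHodge
import Summits.HodgeConjecture.HodgeConjecture.Theses.NoetherLefschetzOneUp

/-!
# Skeleton — crux stmt-HodgeConjecture-2782 `VerticalSupportMiddle`, line `level-regime-split`
(crux-strategist BC2 redirect, unit `cstrat-stmt-HodgeConjecture-2782-r1`, 2026-08-17; namespace per protocol
`Summit.HodgeConjecture.HodgeConjecture.Cruxes.VerticalSupportMiddle.LevelRegimeSplit`)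

The crux AS TYPED is the Hodge conjecture (`verticalSupportMiddle_iff_hodgeConjecture`, landed p140425). This
skeleton is the TYPED DECOMPOSITION of the crux filed by the re-audit: its three stubs are the three PIECES of
`route edit --split VerticalSupportMiddle` (the defs `HodgeFourfoldsChowDegenerate`, `HodgeFourfoldsHeart`,
`SummitGrantedFourfolds` below carry VERBATIM the statements of the future route items of the same names, fully
qualified, the CH₀-hypothesis inlined = `RegimeSplit.ChowZeroDegenerate` by `Iff.rfl`), and `VerticalSupportMiddle_of`
is the split's glue, PROVED:

* `stub_hodgeFourfoldsChowDegenerate` — HC(4;2,2) for CH₀-DEGENERATE fourfolds. Theorem granted a Gysin /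
  cycle-class formalism with Hodge-compatible Gysin morphisms (`hodgeConjectureFor_of_chowZeroDegenerate_fourfold_of_gysin`,
  landed p140569; Conte–Murre / Bloch–Srinivas / Voisin II Prop. 10.26 at `q = 2` with `hodgeBelowDim_four`), i.e.
  modulo the two named facts of the live lead's skeleton (`Fulton1998_degreeFormula_complexOrientation`,
  `topHodgeClasses_spanned_by_pullbacks`): `hodgeFourfoldsChowDegenerate_of_degreeFormula_of_spanning` below.
  Birth: `Lines/p1_chow_degenerate_fourfolds_birth.lean`.
* `stub_hodgeFourfoldsHeart` — HC(4;2,2) for CH₀-NON-DEGENERATE fourfolds (⊇ `p_g > 0`: abelian, HK, CY,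
  general type; Mumford–Roitman). The fourfold heart; open. Birth (route-native: curve nets over ℙ³ +
  `VerticalSupportFourfolds` = crux #4 stmt-2784 + descent at `n = 4`): `Lines/p2_fourfold_heart_birth.lean`.
* `stub_summitGrantedFourfolds` — VERBATIM the shared crux `NoetherLefschetzOneUp.SummitGrantedFourfolds`
  (stmt-HodgeConjecture-14600; crux-attacked gen-1/2: SURVIVES, open-problem; registered dimension-ladder skeleton
  `Cruxes/SummitGrantedFourfolds/Lines/birth.lean`, live lead): the summit granted HC(4;2,2) = the level `q ≥ 3`
  part of this line's middle step (`summitGrantedFourfolds_of_middleStep_three_le` / `middleStep_three_le_of_…`).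

No stub is the crux or the summit: the first two are statements about FOURFOLDS, the third is conditional on
HC(4;2,2) (probes in `BC2-PROBES.md`); all three are HC-true (`stubs_of_hodgeConjecture`) and together they are
exactly HC (`hodgeConjecture_iff_stubStatements`). Why this cut and not heart/CH₀-degenerate over all levels
(line `regime-split-middle-step`): that heart is HC-equivalent BY THEOREM modulo the Gysin debts
(`hodgeConjecture_iff_heart_of_gysin`), so it re-restates the summit the day the debts land; the level cut at
`q = 2` is robust (no correct theorem makes HC for fourfolds, or HC-granted-fourfolds, summit-equivalent).
-/

noncomputable section

set_option linter.dupNamespace false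

open CategoryTheory AlgebraicGeometry
open Literature.AlgebraicGeometry Literature.AlgebraicGeometry.Motives
  Literature.AlgebraicGeometry.HodgeTheory Literature.AlgebraicTopology.SingularHomology
open Summit.HodgeConjecture.HodgeConjecture.Theorems
open Summit.HodgeConjecture.HodgeConjecture.Theorems.RegimeSplit

namespace Summit.HodgeConjecture.HodgeConjecture.Cruxes.VerticalSupportMiddle.LevelRegimeSplit

/-! ### The three pieces of the split (verbatim route-item texts, under the names the route items will carry) -/

/-- Piece P₁ — the text of the future route item `CurveNetMordellWeil.HodgeFourfoldsChowDegenerate` (fully qualified;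
the CH₀-hypothesis inlined = `RegimeSplit.ChowZeroDegenerate X`, `hodgeFourfoldsChowDegenerate_iff`). HC(4;2,2) for
CH₀-degenerate fourfolds. [cite: VoisinHodgeII2003, Prop. 10.26] [cite: ConteMurre1978] -/
def HodgeFourfoldsChowDegenerate : Prop :=
  ∀ ⦃X : Literature.AlgebraicGeometry.Motives.SchemeOver ℂ⦄, Literature.AlgebraicGeometry.Motives.IsSmoothProjective 4 X → (∃ W : Set X.left, IsClosed W ∧ W ≠ Set.univ ∧ ∀ z ∈ Literature.AlgebraicGeometry.Motives.cyclesOfDim X.left 0, ∃ z' ∈ Literature.AlgebraicGeometry.Motives.cyclesOfDim X.left 0, (∀ x, z' x ≠ 0 → x ∈ W) ∧ Literature.AlgebraicGeometry.Motives.IsRationallyEquivalent z z' 0) → ∀ c : Literature.AlgebraicGeometry.HodgeTheory.complexBetti X (2 * 2), Literature.AlgebraicGeometry.HodgeTheory.IsRationalClass c → Literature.AlgebraicGeometry.HodgeTheory.IsOfHodgeType 4 X (2 * 2) 2 2 c → c ∈ Literature.AlgebraicGeometry.HodgeTheory.algebraicClasses X 2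

/-- Piece P₂ — the text of the future route item `CurveNetMordellWeil.HodgeFourfoldsHeart`. HC(4;2,2) for
CH₀-non-degenerate fourfolds (the fourfold heart). [cite: VoisinHodgeII2003, Thm. 10.17] [cite: Deligne2000, §1] -/
def HodgeFourfoldsHeart : Prop :=
  ∀ ⦃X : Literature.AlgebraicGeometry.Motives.SchemeOver ℂ⦄, Literature.AlgebraicGeometry.Motives.IsSmoothProjective 4 X → ¬ (∃ W : Set X.left, IsClosed W ∧ W ≠ Set.univ ∧ ∀ z ∈ Literature.AlgebraicGeometry.Motives.cyclesOfDim X.left 0, ∃ z' ∈ Literature.AlgebraicGeometry.Motives.cyclesOfDim X.left 0, (∀ x, z' x ≠ 0 → x ∈ W) ∧ Literature.AlgebraicGeometry.Motives.IsRationallyEquivalent z z' 0) → ∀ c : Literature.AlgebraicGeometry.HodgeTheory.complexBetti X (2 * 2), Literature.AlgebraicGeometry.HodgeTheory.IsRationalClass c → Literature.AlgebraicGeometry.HodgeTheory.IsOfHodgeType 4 X (2 * 2) 2 2 c → c ∈ Literature.AlgebraicGeometry.HodgeTheory.algebraicClasses X 2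

/-- Piece P₃ — the text of the future route item `CurveNetMordellWeil.SummitGrantedFourfolds`, VERBATIM the shared crux
`NoetherLefschetzOneUp.SummitGrantedFourfolds` (stmt-HodgeConjecture-14600; `summitGrantedFourfolds_eq_shared` is `rfl`).
[cite: Deligne2000, §1] [cite: BrosnanFangNiePearlstein2009, §6 Lemma 48] -/
def SummitGrantedFourfolds : Prop :=
  (∀ ⦃X : Literature.AlgebraicGeometry.Motives.SchemeOver ℂ⦄, Literature.AlgebraicGeometry.Motives.IsSmoothProjective 4 X → ∀ c : Literature.AlgebraicGeometry.HodgeTheory.complexBetti X (2 * 2), Literature.AlgebraicGeometry.HodgeTheory.IsRationalClass c → Literature.AlgebraicGeometry.HodgeTheory.IsOfHodgeType 4 X (2 * 2) 2 2 c → c ∈ Literature.AlgebraicGeometry.HodgeTheory.algebraicClasses X 2) → ∀ ⦃n : ℕ⦄ ⦃X : Literature.AlgebraicGeometry.Motives.SchemeOver ℂ⦄, Literature.AlgebraicGeometry.Motives.IsSmoothProjective n X → Nonempty (Literature.AlgebraicGeometry.HodgeTheory.HodgeModel n X) ∧ ∀ (p : ℕ) (c : Literature.AlgebraicGeometry.HodgeTheory.complexBetti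 X (2 * p)), Literature.AlgebraicGeometry.HodgeTheory.IsRationalClass c → Literature.AlgebraicGeometry.HodgeTheory.IsOfHodgeType n X (2 * p) p p c → c ∈ Literature.AlgebraicGeometry.HodgeTheory.algebraicClasses X p

theorem hodgeFourfoldsChowDegenerate_iff :
    HodgeFourfoldsChowDegenerate ↔ ∀ ⦃X : SchemeOver ℂ⦄, IsSmoothProjective 4 X → ChowZeroDegenerate X →
      ∀ c : complexBetti X (2 * 2), IsRationalClass c → IsOfHodgeType 4 X (2 * 2) 2 2 c → c ∈ algebraicClasses X 2 :=
  Iff.rfl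

theorem hodgeFourfoldsHeart_iff :
    HodgeFourfoldsHeart ↔ ∀ ⦃X : SchemeOver ℂ⦄, IsSmoothProjective 4 X → ¬ ChowZeroDegenerate X →
      ∀ c : complexBetti X (2 * 2), IsRationalClass c → IsOfHodgeType 4 X (2 * 2) 2 2 c → c ∈ algebraicClasses X 2 :=
  Iff.rfl

/-- P₃ IS the shared item's decl, definitionally. -/
theorem summitGrantedFourfolds_eq_shared :
    SummitGrantedFourfolds = Summit.HodgeConjecture.HodgeConjecture.Theses.NoetherLefschetzOneUp.SummitGrantedFourfolds :=
  rfl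

theorem summitGrantedFourfolds_iff :
    SummitGrantedFourfolds ↔ ((∀ ⦃X : SchemeOver ℂ⦄, IsSmoothProjective 4 X → ∀ c : complexBetti X (2 * 2),
      IsRationalClass c → IsOfHodgeType 4 X (2 * 2) 2 2 c → c ∈ algebraicClasses X 2) → _root_.HodgeConjecture) :=
  Iff.rfl

/-! ### The three stubs = the three pieces -/

/-- **Stub / piece P₁: HC(4;2,2) for CH₀-degenerate fourfolds** (route item `HodgeFourfoldsChowDegenerate`).
Theorem modulo the Gysin debts (`hodgeFourfoldsChowDegenerate_of_degreeFormula_of_spanning`). [size L: the debts]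
[cite: VoisinHodgeII2003, Prop. 10.26] [cite: ConteMurre1978] [cite: BlochSrinivas1983] -/
theorem stub_hodgeFourfoldsChowDegenerate : HodgeFourfoldsChowDegenerate := by
  sorry

/-- **Stub / piece P₂: HC(4;2,2) for CH₀-non-degenerate fourfolds — the fourfold heart** (route item
`HodgeFourfoldsHeart`). Open (abelian fourfolds: Markman 2025 + Moonen–Zarhin; Fermat; K3×K3 with a Hodge isometry;
the rest open). [size: open-problem, strictly below the summit]
[cite: VoisinHodgeII2003, Thm. 10.17] [cite: Markman2025SecantWeil] [cite: Zucker1977] -/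
theorem stub_hodgeFourfoldsHeart : HodgeFourfoldsHeart := by
  sorry

/-- **Stub / piece P₃: the summit granted the fourfold middle degree** — VERBATIM
`NoetherLefschetzOneUp.SummitGrantedFourfolds` (stmt-HodgeConjecture-14600, shared crux with a registered skeleton
and a live lead). [size: open-problem above dimension 4, conditional]
[cite: Deligne2000, §1] [cite: BrosnanFangNiePearlstein2009, §6 Lemma 48] [cite: vanGeemen1994HodgeAV] -/
theorem stub_summitGrantedFourfolds : SummitGrantedFourfolds := by
  sorry

/-- Local ABBREVIATION of the crux decl (so that only `VerticalSupportMiddle_of_stubs` below concludes the crux BY NAME and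
is taken as the skeleton theorem by `#h21_check_skeleton`; the glue forms conclude this abbreviation, which unfolds to it). -/
abbrev Crux : Prop := Summit.HodgeConjecture.HodgeConjecture.Theses.CurveNetMordellWeil.VerticalSupportMiddle

/-! ### The composition (= the glue of the split), PROVED -/

/-- **THE LINE'S COMPOSITION = THE GLUE OF THE SPLIT: the three pieces → the crux `VerticalSupportMiddle` BY NAME**
(sorry-free). HC(4;2,2) by the classical case split on CH₀-degeneracy of the fourfold; the summit by piece 3 (its
conclusion is `HodgeConjectureFor n X` unfolded); the crux by the landed `verticalSupportMiddle_of_hodgeConjecture`.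
[cite: Deligne2000, §1] [cite: VoisinHodgeII2003, Cor. 10.21 and Thm. 10.17] -/
theorem VerticalSupportMiddle_of :
    HodgeFourfoldsChowDegenerate → HodgeFourfoldsHeart → SummitGrantedFourfolds → Crux := by
  intro h₁ h₂ h₃
  refine verticalSupportMiddle_of_hodgeConjecture fun n X hX ↦ h₃ (fun Y hY c hc hh ↦ ?_) hX
  by_cases hW : ChowZeroDegenerate Y
  · exact h₁ hY hW c hc hh
  · exact h₂ hY hW c hc hh

/-- **THE SKELETON THEOREM: the crux BY NAME, closed modulo exactly the three stubs** (the only theorem of this file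
whose conclusion is literally the crux decl). -/
theorem VerticalSupportMiddle_of_stubs :
    Summit.HodgeConjecture.HodgeConjecture.Theses.CurveNetMordellWeil.VerticalSupportMiddle :=
  VerticalSupportMiddle_of stub_hodgeFourfoldsChowDegenerate stub_hodgeFourfoldsHeart stub_summitGrantedFourfolds

/-- The same glue with every piece statement written out (the exact type of the route's glue item after
`route edit --split`). [cite: Deligne2000, §1] -/
theorem VerticalSupportMiddle_of_unfolded :
    (∀ ⦃X : Literature.AlgebraicGeometry.Motives.SchemeOver ℂ⦄, Literature.AlgebraicGeometry.Motives.IsSmoothProjective 4 X → (∃ W : Set X.left, IsClosed W ∧ W ≠ Set.univ ∧ ∀ z ∈ Literature.AlgebraicGeometry.Motives.cyclesOfDim X.left 0, ∃ z' ∈ Literature.AlgebraicGeometry.Motives.cyclesOfDim X.left 0, (∀ x, z' x ≠ 0 → x ∈ W) ∧ Literature.AlgebraicGeometry.Motives.IsRationallyEquivalent z z' 0) → ∀ c : Literature.AlgebraicGeometry.HodgeTheory.complexBetti X (2 * 2), Literature.AlgebraicGeometry.HodgeTheory.IsRationalClass c → Literature.AlgebraicGeometry.HodgeTheory.IsOfHodgeType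 4 X (2 * 2) 2 2 c → c ∈ Literature.AlgebraicGeometry.HodgeTheory.algebraicClasses X 2) →
    (∀ ⦃X : Literature.AlgebraicGeometry.Motives.SchemeOver ℂ⦄, Literature.AlgebraicGeometry.Motives.IsSmoothProjective 4 X → ¬ (∃ W : Set X.left, IsClosed W ∧ W ≠ Set.univ ∧ ∀ z ∈ Literature.AlgebraicGeometry.Motives.cyclesOfDim X.left 0, ∃ z' ∈ Literature.AlgebraicGeometry.Motives.cyclesOfDim X.left 0, (∀ x, z' x ≠ 0 → x ∈ W) ∧ Literature.AlgebraicGeometry.Motives.IsRationallyEquivalent z z' 0) → ∀ c : Literature.AlgebraicGeometry.HodgeTheory.complexBetti X (2 * 2), Literature.AlgebraicGeometry.HodgeTheory.IsRationalClass c → Literature.AlgebraicGeometry.HodgeTheory.IsOfHodgeType 4 X (2 * 2) 2 2 c → c ∈ Literature.AlgebraicGeometry.HodgeTheory.algebraicClasses X 2) →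
    ((∀ ⦃X : Literature.AlgebraicGeometry.Motives.SchemeOver ℂ⦄, Literature.AlgebraicGeometry.Motives.IsSmoothProjective 4 X → ∀ c : Literature.AlgebraicGeometry.HodgeTheory.complexBetti X (2 * 2), Literature.AlgebraicGeometry.HodgeTheory.IsRationalClass c → Literature.AlgebraicGeometry.HodgeTheory.IsOfHodgeType 4 X (2 * 2) 2 2 c → c ∈ Literature.AlgebraicGeometry.HodgeTheory.algebraicClasses X 2) → ∀ ⦃n : ℕ⦄ ⦃X : Literature.AlgebraicGeometry.Motives.SchemeOver ℂ⦄, Literature.AlgebraicGeometry.Motives.IsSmoothProjective n X → Nonempty (Literature.AlgebraicGeometry.HodgeTheory.HodgeModel n X) ∧ ∀ (p : ℕ) (c : Literature.AlgebraicGeometry.HodgeTheory.complexBetti X (2 * p)), Literature.AlgebraicGeometry.HodgeTheory.IsRationalClass c → Literature.AlgebraicGeometry.HodgeTheory.IsOfHodgeType n X (2 * p) p p c → c ∈ Literature.AlgebraicGeometry.HodgeTheory.algebraicClasses X p) →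
    Crux :=
  VerticalSupportMiddle_of

/-! ### Sanity (all sorry-free, do not use the stubs) -/

/-- Piece P₁ is a THEOREM granted a Gysin / cycle-class formalism with Hodge-compatible Gysin morphisms
(landed `hodgeConjectureFor_of_chowZeroDegenerate_fourfold_of_gysin`). [cite: ConteMurre1978]
[cite: VoisinHodgeII2003, Prop. 10.26] -/
theorem hodgeFourfoldsChowDegenerate_of_gysin (G : GysinFormalism) (hG : G.IsGysinHodgeCompatible) :
    ∀ ⦃X : SchemeOver ℂ⦄, IsSmoothProjective 4 X → ChowZeroDegenerate X →
      ∀ c : complexBetti X (2 * 2), IsRationalClass c → IsOfHodgeType 4 X (2 * 2) 2 2 c → c ∈ algebraicClasses X 2 :=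
  fun _ hX hW c hc hh ↦ (hodgeConjectureFor_of_chowZeroDegenerate_fourfold_of_gysin G hG hX hW).2 2 c hc hh

/-- Piece P₁ from the two named facts of the live lead's skeleton (the line's trust base).
[cite: Fulton1998, Lemma 19.1.2] [cite: VoisinHodgeI2002, Thm. 11.30] -/
theorem hodgeFourfoldsChowDegenerate_of_degreeFormula_of_spanning
    (hB : Fulton1998_degreeFormula_complexOrientation) (hS : topHodgeClasses_spanned_by_pullbacks) :
    ∀ ⦃X : SchemeOver ℂ⦄, IsSmoothProjective 4 X → ChowZeroDegenerate X →
      ∀ c : complexBetti X (2 * 2), IsRationalClass c → IsOfHodgeType 4 X (2 * 2) 2 2 c → c ∈ algebraicClasses X 2 :=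
  fun _ hX hW c hc hh ↦
    middleStepChowDegenerate_of_degreeFormula_of_spanning hB hS le_rfl hX hodgeBelowDim_four hW c hc hh

/-- All three stub STATEMENTS follow from the Hodge conjecture (none is refutable short of `¬HC`). [cite: Deligne2000, §1] -/
theorem stubs_of_hodgeConjecture (h : _root_.HodgeConjecture) :
    (∀ ⦃X : SchemeOver ℂ⦄, IsSmoothProjective 4 X → ChowZeroDegenerate X →
      ∀ c : complexBetti X (2 * 2), IsRationalClass c → IsOfHodgeType 4 X (2 * 2) 2 2 c → c ∈ algebraicClasses X 2) ∧
    (∀ ⦃X : SchemeOver ℂ⦄, IsSmoothProjective 4 X → ¬ ChowZeroDegenerate X →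
      ∀ c : complexBetti X (2 * 2), IsRationalClass c → IsOfHodgeType 4 X (2 * 2) 2 2 c → c ∈ algebraicClasses X 2) ∧
    ((∀ ⦃X : SchemeOver ℂ⦄, IsSmoothProjective 4 X → ∀ c : complexBetti X (2 * 2), IsRationalClass c →
        IsOfHodgeType 4 X (2 * 2) 2 2 c → c ∈ algebraicClasses X 2) → _root_.HodgeConjecture) :=
  ⟨fun _ hX _ c hc hh ↦ (h hX).2 2 c hc hh, fun _ hX _ c hc hh ↦ (h hX).2 2 c hc hh, fun _ ↦ h⟩

/-- The split is exhaustive: the three stub statements together are exactly the Hodge conjecture, hence exactly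
the crux (`verticalSupportMiddle_iff_hodgeConjecture`). [cite: Deligne2000, §1] -/
theorem hodgeConjecture_iff_stubStatements :
    _root_.HodgeConjecture ↔
    ((∀ ⦃X : SchemeOver ℂ⦄, IsSmoothProjective 4 X → ChowZeroDegenerate X →
      ∀ c : complexBetti X (2 * 2), IsRationalClass c → IsOfHodgeType 4 X (2 * 2) 2 2 c → c ∈ algebraicClasses X 2) ∧
    (∀ ⦃X : SchemeOver ℂ⦄, IsSmoothProjective 4 X → ¬ ChowZeroDegenerate X →
      ∀ c : complexBetti X (2 * 2), IsRationalClass c → IsOfHodgeType 4 X (2 * 2) 2 2 c → c ∈ algebraicClasses X 2) ∧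
    ((∀ ⦃X : SchemeOver ℂ⦄, IsSmoothProjective 4 X → ∀ c : complexBetti X (2 * 2), IsRationalClass c →
        IsOfHodgeType 4 X (2 * 2) 2 2 c → c ∈ algebraicClasses X 2) → _root_.HodgeConjecture)) := by
  refine ⟨stubs_of_hodgeConjecture, fun ⟨h₁, h₂, h₃⟩ ↦ h₃ fun Y hY c hc hh ↦ ?_⟩
  by_cases hW : ChowZeroDegenerate Y
  · exact h₁ hY hW c hc hh
  · exact h₂ hY hW c hc hh

/-- Piece P₃ is the level-`≥ 3` part of the line's middle step: granted HC(4;2,2), the middle step restricted to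
`q ≥ 3` gives the summit through the landed level-wise reduction `hodgeConjecture_of_middleStep`.
[cite: KerrPearlstein2011, §3.1] -/
theorem summitGrantedFourfolds_of_middleStep_three_le
    (h : ∀ ⦃q : ℕ⦄ ⦃X : SchemeOver ℂ⦄, 3 ≤ q → IsSmoothProjective (2 * q) X → HodgeBelowDim (2 * q) →
      ∀ c : complexBetti X (2 * q), IsRationalClass c → IsOfHodgeType (2 * q) X (2 * q) q q c → c ∈ algebraicClasses X q)
    (h42 : ∀ ⦃X : SchemeOver ℂ⦄, IsSmoothProjective 4 X → ∀ c : complexBetti X (2 * 2), IsRationalClass c →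
      IsOfHodgeType 4 X (2 * 2) 2 2 c → c ∈ algebraicClasses X 2) :
    _root_.HodgeConjecture := by
  refine hodgeConjecture_of_middleStep fun q Y hq hY ih _ c hc hh ↦ ?_
  rcases Nat.lt_or_ge q 3 with hq3 | hq3
  · obtain rfl : q = 2 := by omega
    exact h42 hY c hc hh
  · exact h hq3 hY ih c hc hh

/-- Conversely the summit-granted-fourfolds statement gives the level-`≥ 3` middle step (its induction hypothesis
contains HC(4;2,2) since `4 < 2q`). [cite: KerrPearlstein2011, §3.1] -/
theorem middleStep_three_le_of_summitGrantedFourfolds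
    (h : (∀ ⦃X : SchemeOver ℂ⦄, IsSmoothProjective 4 X → ∀ c : complexBetti X (2 * 2), IsRationalClass c →
        IsOfHodgeType 4 X (2 * 2) 2 2 c → c ∈ algebraicClasses X 2) → _root_.HodgeConjecture)
    ⦃q : ℕ⦄ ⦃X : SchemeOver ℂ⦄ (hq : 3 ≤ q) (hX : IsSmoothProjective (2 * q) X) (ih : HodgeBelowDim (2 * q))
    (c : complexBetti X (2 * q)) (hc : IsRationalClass c) (hh : IsOfHodgeType (2 * q) X (2 * q) q q c) :
    c ∈ algebraicClasses X q :=
  (h (fun _ hY c' hc' hh' ↦ ih (by omega) hY 2 c' hc' hh') hX).2 q c hc hh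

/-- The previous line's heart (all levels) implies pieces P₂ and — with the CH₀-degenerate regime — P₃; recorded so
that the two skeletons on this crux are comparable: this line REFINES `regime-split-middle-step` by the level cut.
[cite: VoisinHodgeII2003, Thm. 10.17] -/
theorem hodgeFourfoldsHeart_of_heartland (hH : MiddleStepFor fun X ↦ ¬ ChowZeroDegenerate X) :
    ∀ ⦃X : SchemeOver ℂ⦄, IsSmoothProjective 4 X → ¬ ChowZeroDegenerate X →
      ∀ c : complexBetti X (2 * 2), IsRationalClass c → IsOfHodgeType 4 X (2 * 2) 2 2 c → c ∈ algebraicClasses X 2 :=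
  fun _ hX hW c hc hh ↦ hH le_rfl hX hodgeBelowDim_four hW c hc hh

end Summit.HodgeConjecture.HodgeConjecture.Cruxes.VerticalSupportMiddle.LevelRegimeSplit

end
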